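import Literature.AlgebraicGeometry.Frobenioids.Thm42Sub
import Literature.AlgebraicGeometry.Frobenioids.Thm42PerfectReduction
import HarnessLib

/-!
# [FrdI] Theorem 4.2 (i), row T42-L03: the slot `FrdI.T42.PerfectWLOG` DISCHARGED

Mochizuki, *The geometry of Frobenioids I: the general theory*, Kyushu J. Math. **62** (2008)
293–400, §4, Theorem 4.2 (i), proof p. 78 ll. 40–46 [cite: MochizukiFrdI2008, Thm. 4.2 (i) p.78]:
"clearly it suffices to do so after passing to the perfections of the `C_i` [cf. Theorem 3.4, (iii)]".

PROOF-ONLY closer (sub-DAG `plan/L1/SUBDAG-FrdI-Thm42-Thm49.md`, row `FrdI:Thm4.2(i)/T42-L03`): the named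
statement `FrdI.T42.PerfectWLOG` of the statements file `Thm42Sub.lean` (seat abc-iut-L1-t14) IS the type
of `FrdI.T42.perfectWLOG_transport` (`Thm42PerfectReduction.lean`), so the slot closes by that term. The
instantiation at the tree's perfections is `Thm42PerfectionReduction.lean`. Nothing new is asserted.
-/

namespace Literature.AlgebraicGeometry.Frobenioids

namespace FrdI.T42

/-- **T42-L03 `PerfectWLOG` holds** — the transport principle "it suffices to pass to the perfections"
([FrdI] Thm. 4.2 (i), proof p. 78 ll. 40–46), by `perfectWLOG_transport`.
[cite: MochizukiFrdI2008, Thm. 4.2 (i) p.78] -/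
theorem PerfectWLOG_holds : PerfectWLOG := perfectWLOG_transport

end FrdI.T42

end Literature.AlgebraicGeometry.Frobenioids
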